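import Literature.AnabelianGeometry.SemiGraphs.ArithNotEdgeLikeOfVerticialOuterAction
import Literature.AnabelianGeometry.SemiGraphs.ArithTemperedGroupOfOuterAction
import Literature.AnabelianGeometry.SemiGraphs.WitnessIwahoriBundle
import HarnessLib

/-!
# [SemiAnbd] Def 5.1 (i) design inputs `hV` / `hE` for an ARBITRARY outer action at a semi-graph with ONE
# vertex (resp. ONE edge) — the loop witness `𝒢₁` included (support for the non-split `hest` witness search)

Mochizuki, *Semi-graphs of anabelioids*, Publ. RIMS **42** (2006) 221–322, §3 Thm 3.7 (iv) p. 41 ("The maximal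
compact subgroups of `π₁^temp(𝒢)` are precisely the verticial subgroups …"), §5 Def 5.1 (i) p. 62, Thm 5.4
p. 66. [cite: MochizukiSemiAnbd2006, Def 5.1 (i), p. 62]

PROOF-ONLY file (abc-iut cell, L3 sub-DAG `plan/L3/SUBDAG-SemiAnbd-Thm54.md`, NV support for the row
«NV-hest-NONSPLIT» (abc-iut-w6-d099) per L3-lead α77's split «d040 = the general criterion»; seat
abc-iut-w4-d040 gen 4).  No definition, no new named fact.  The T54-B capstone's design binders `hV`, `hE`
(abc-iut-w4-d082's currency: some representative of `ρ(a)` carries verticial subgroups at `v` to verticial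
subgroups at `a • v`, edge-like at `e` to edge-like at `a • e`) have so far been inhabited only at the TRIVIAL
outer action (abc-iut-w6-d099).  Here: they hold for EVERY outer action `ρ : Π_A → Out(π₁^temp 𝒢)` and EVERY
base action, as soon as the underlying semi-graph has a single vertex (resp. a single edge) — because every
bi-continuous automorphism permutes the verticial (resp. edge-like) subgroups (Thm 3.7 (iv) at `𝒢`,
abc-iut-w5-d215's `exists_mem_verticialSubgroups_map_contMulAut_of_at` /
`exists_mem_edgeLikeSubgroups_map_contMulAut_of_at`) and there is only one vertex (edge) to land at:

* `hV_of_subsingleton_vertex`, `hE_of_subsingleton_edge` — At-form (binder `CompactInVerticialAt 𝒢`);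
* `IwahoriWitness.hV_loopGraph`, `IwahoriWitness.hE_loopGraph` — at the estranged loop `𝒢₁ = loopGraph p`
  (abc-iut-w5-d236), hypothesis-free, for every chart, every `Π_A`, every `ρ`, every base action.

So at `𝒢₁` the design side of Thm 5.4 for an arbitrary (non-split) `ρ` with trivial base action reduces to
the pair clause `hBR` («`ρ(a)` preserves the two branch classes inside `Π_v`») and `hest` (subject to the
criterion of `ArithTotalEstrangementOpenKernelObstruction.lean`).  Nothing here bears on [IUTchIII] Cor. 3.12;
typed ≠ proved.
-/

namespace Literature.AnabelianGeometry.SemiGraphs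

universe u w

namespace ProfiniteSemiGraph

open Literature.AnabelianGeometry.EtaleTheta CategoryTheory Topology

variable {𝒢 : ProfiniteSemiGraph.{u}} (c : TemperedPiChart 𝒢) {PA : Type w} [Group PA]
  (ρ : PA →* TopOut c.G) (baseAct : PA →* Aut 𝒢.graph)

/-- **`hV` for EVERY outer action at a one-vertex semi-graph of anabelioids** (Def 5.1 (i) / Prop 3.6 (iv)
at `ρ_𝔾(a)`, verticial subgroups): any representative `φ` of `ρ(a)` carries a verticial subgroup at `v` to a
verticial subgroup at SOME vertex (Thm 3.7 (iv) at `𝒢`), which is `a • v` since there is only one.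
[cite: MochizukiSemiAnbd2006, Def 5.1 (i), p. 62] -/
theorem hV_of_subsingleton_vertex [Subsingleton 𝒢.graph.Vertex] (hiii : CompactInVerticialAt 𝒢)
    (h37 : 𝒢.Thm37Hypotheses) :
    ∀ (a : PA) (v : 𝒢.graph.Vertex) (H : Subgroup c.G), H ∈ verticialSubgroups c v →
      ∃ φ : contMulAut c.G, TopOut.mk c.G φ = ρ a ∧
        H.map (φ : MulAut c.G).toMonoidHom ∈ verticialSubgroups c ((baseAct a).hom.vertexMap v) := by
  intro a v H hH
  obtain ⟨φ, hφ⟩ := QuotientGroup.mk_surjective (ρ a)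
  obtain ⟨w, hw⟩ := exists_mem_verticialSubgroups_map_contMulAut_of_at
    (maximalCompactIffVerticialAt_of_compactInVerticialAt hiii) h37 c φ hH
  exact ⟨φ, hφ, (Subsingleton.elim w ((baseAct a).hom.vertexMap v)) ▸ hw⟩

/-- **`hE` for EVERY outer action at a one-edge graph of anabelioids** (Def 5.1 (i) / Prop 3.6 (iv) at
`ρ_𝔾(a)`, edge-like subgroups): any representative of `ρ(a)` carries an edge-like subgroup of `e` to an edge-like
subgroup of SOME edge (Thm 3.7 (iv) at `𝒢`, `𝔾` a graph), which is `a • e`.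
[cite: MochizukiSemiAnbd2006, Def 5.1 (i), p. 62] -/
theorem hE_of_subsingleton_edge [Subsingleton 𝒢.graph.Edge] (hiii : CompactInVerticialAt 𝒢)
    (h37 : 𝒢.Thm37Hypotheses) (hG : 𝒢.graph.IsGraph) :
    ∀ (a : PA) (e : 𝒢.graph.Edge) (K : Subgroup c.G), K ∈ edgeLikeSubgroups c e →
      ∃ φ : contMulAut c.G, TopOut.mk c.G φ = ρ a ∧
        K.map (φ : MulAut c.G).toMonoidHom ∈ edgeLikeSubgroups c ((baseAct a).hom.edgeMap e) := by
  intro a e K hK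
  obtain ⟨φ, hφ⟩ := QuotientGroup.mk_surjective (ρ a)
  obtain ⟨e', he'⟩ := exists_mem_edgeLikeSubgroups_map_contMulAut_of_at
    (maximalCompactIffVerticialAt_of_compactInVerticialAt hiii) h37 hG c φ hK
  exact ⟨φ, hφ, (Subsingleton.elim e' ((baseAct a).hom.edgeMap e)) ▸ he'⟩

/-- Hence at a one-vertex, one-edge graph of anabelioids, abc-iut-w4-d053's chart-action package
`ArithChartAction` holds at `π₁^temp(𝒢) ⋊^out Π_A` for EVERY outer action `ρ`, given only Def 5.1 (i)(c) for
the base action (`hopen`). [cite: MochizukiSemiAnbd2006, Def 5.1 (i), p. 62] -/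
theorem arithChartAction_outerAction_of_subsingleton [Subsingleton 𝒢.graph.Vertex]
    [Subsingleton 𝒢.graph.Edge] [TopologicalSpace PA] (hiii : CompactInVerticialAt 𝒢)
    (h37 : 𝒢.Thm37Hypotheses) (hG : 𝒢.graph.IsGraph)
    (hopen : ∃ U : Subgroup PA, IsOpen (U : Set PA) ∧ ∀ a ∈ U,
      (∀ v, (baseAct a).hom.vertexMap v = v) ∧ (∀ e, (baseAct a).hom.edgeMap e = e) ∧
        ∀ b, (baseAct a).hom.branchMap b = b) :
    ArithChartAction c (toOuterSemidirectProduct ρ) (outerSemidirectProductSnd ρ)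
      (fun a v => (baseAct a).hom.vertexMap v) (fun a e => (baseAct a).hom.edgeMap e)
      (fun a b => (baseAct a).hom.branchMap b) :=
  arithChartAction_outerAction c ρ baseAct (hV_of_subsingleton_vertex c ρ baseAct hiii h37)
    (hE_of_subsingleton_edge c ρ baseAct hiii h37 hG) hopen

end ProfiniteSemiGraph

/-! ### At the estranged loop `𝒢₁` -/

namespace IwahoriWitness

open ProfiniteSemiGraph Literature.AnabelianGeometry.EtaleTheta CategoryTheory

variable (p : ℕ) [Fact p.Prime] {PA : Type w} [Group PA]

/-- The bouquet has a single vertex. [cite: MochizukiSemiAnbd2006, §1 p.11] -/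
theorem subsingleton_loopGraph_vertex : Subsingleton (loopGraph p).graph.Vertex :=
  show Subsingleton PUnit from inferInstance

/-- The bouquet has a single edge. [cite: MochizukiSemiAnbd2006, §1 p.11] -/
theorem subsingleton_loopGraph_edge : Subsingleton (loopGraph p).graph.Edge :=
  show Subsingleton (ULift (Fin 1)) from inferInstance

/-- **`hV` at the estranged loop `𝒢₁` for EVERY outer action `ρ` and every base action** (hypothesis-free:
Thm 3.7 (iii) holds at `𝒢₁` by `compactInVerticialAt_of_finiteGraph`, its hypotheses by
`loopGraph_thm37Hypotheses`). [cite: MochizukiSemiAnbd2006, Def 5.1 (i), p. 62] -/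
theorem hV_loopGraph (c : TemperedPiChart (loopGraph p)) (ρ : PA →* TopOut c.G)
    (baseAct : PA →* Aut (loopGraph p).graph) :
    ∀ (a : PA) (v : (loopGraph p).graph.Vertex) (H : Subgroup c.G), H ∈ verticialSubgroups c v →
      ∃ φ : contMulAut c.G, TopOut.mk c.G φ = ρ a ∧
        H.map (φ : MulAut c.G).toMonoidHom ∈ verticialSubgroups c ((baseAct a).hom.vertexMap v) :=
  haveI := subsingleton_loopGraph_vertex p
  haveI : Finite (loopGraph p).graph.Vertex := show Finite PUnit from inferInstance
  haveI : Finite (loopGraph p).graph.Edge := show Finite (ULift (Fin 1)) from inferInstance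
  hV_of_subsingleton_vertex c ρ baseAct compactInVerticialAt_of_finiteGraph (loopGraph_thm37Hypotheses p)

/-- **`hE` at the estranged loop `𝒢₁` for EVERY outer action `ρ` and every base action**.
[cite: MochizukiSemiAnbd2006, Def 5.1 (i), p. 62] -/
theorem hE_loopGraph (c : TemperedPiChart (loopGraph p)) (ρ : PA →* TopOut c.G)
    (baseAct : PA →* Aut (loopGraph p).graph) :
    ∀ (a : PA) (e : (loopGraph p).graph.Edge) (K : Subgroup c.G), K ∈ edgeLikeSubgroups c e →
      ∃ φ : contMulAut c.G, TopOut.mk c.G φ = ρ a ∧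
        K.map (φ : MulAut c.G).toMonoidHom ∈ edgeLikeSubgroups c ((baseAct a).hom.edgeMap e) :=
  haveI := subsingleton_loopGraph_edge p
  haveI : Finite (loopGraph p).graph.Vertex := show Finite PUnit from inferInstance
  haveI : Finite (loopGraph p).graph.Edge := show Finite (ULift (Fin 1)) from inferInstance
  hE_of_subsingleton_edge c ρ baseAct compactInVerticialAt_of_finiteGraph (loopGraph_thm37Hypotheses p)
    (loopGraph_isGraph p)

/-- **The chart-action package at `𝒢₁` for EVERY outer action `ρ` and the trivial base action** (`hopen` with
`U := ⊤`): `ArithChartAction c ι aug 1 1 1` at `π₁^temp(𝒢₁) ⋊^out Π_A`.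
[cite: MochizukiSemiAnbd2006, Def 5.1 (i), p. 62] -/
theorem arithChartAction_loopGraph [TopologicalSpace PA] (c : TemperedPiChart (loopGraph p))
    (ρ : PA →* TopOut c.G) :
    ArithChartAction c (toOuterSemidirectProduct ρ) (outerSemidirectProductSnd ρ)
      (fun a v => ((1 : PA →* Aut (loopGraph p).graph) a).hom.vertexMap v)
      (fun a e => ((1 : PA →* Aut (loopGraph p).graph) a).hom.edgeMap e)
      (fun a b => ((1 : PA →* Aut (loopGraph p).graph) a).hom.branchMap b) :=
  arithChartAction_outerAction c ρ 1 (hV_loopGraph p c ρ 1) (hE_loopGraph p c ρ 1)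
    ⟨⊤, by simp, fun _ _ => ⟨fun _ => rfl, fun _ => rfl, fun _ => rfl⟩⟩

end IwahoriWitness

end Literature.AnabelianGeometry.SemiGraphs
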